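import Mathlib
import Summits.NavierStokesRegularity.NavierStokesRegularity.Theorems.SubOnsagerCeilingGapFamily
import HarnessLib

/-!
# The design «d145θ» as a `GapFamily.Params` datum, with its admissibility
(helper file for crux stmt-NavierStokesRegularity-27057 `SubOnsagerCeiling.ForwardTailCeilingKP`, `--supports … --as helper`;
LEAD SOC g11, line «kp-shell-barrier», parametric route)

`d145θ` = the coefficients found by the LEAD's bound-based certifier-in-the-loop fitter (`fit2.py`, ≈ 20 iterations from
«d147θ») for the slice `b ∈ [29/20, 147/100]`; same topology (caps 49/50, cubic floors 9/20·x³ − 1/1000, re-tuned corner caps and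
quadric floors).
`d145θ_adm : d145θ.Adm` (decided by `norm_num`) and `d145θ_a0 : d145θ.a0 ≠ 0`. HONEST FRAMING: MODEL-lattice datum; nothing
here bears on Navier–Stokes regularity; 27057 stays OPEN. [cite: BarbatoMorandinRomito2011, §2 Lemma 2.1]
-/

noncomputable section

-- the sub-problem namespace `NavierStokesRegularity.NavierStokesRegularity` is the tree's layout (D-0017)
set_option linter.dupNamespace false

namespace Summit.NavierStokesRegularity.NavierStokesRegularity.Theorems.VirtualFloor.GapFamily

/-- The design «d145θ». [folklore] -/
def d145θ : Params := { kap := (9/20), eps := (1/1000), a0 := (74397/25000), a1 := (52683/50000), a2 := (3227/100000), ac := (93447/25000), b1 := (37647/20000), bc := (134493/50000), fc := (-136473/25000), f0 := (105307/100000), f1 := (564527/100000), f2 := (84621/50000), f00 := (1169/100000), f11 := (24207/25000), f22 := (41971/10000), f01 := (-19/20000), f02 := (-121113/100000), f12 := (-38189/6250), gc := (-87411/25000), g0 := (13541/25000), g1 := (503911/100000), g2 := (-54911/10000), g00 := (763/10000), g11 := (87/12500), g22 := (458933/100000), g01 := (262/3125), g02 := (-2109/100000), g12 := (-1053/25000)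 }

/-- «d145θ» is admissible. [folklore] -/
theorem d145θ_adm : d145θ.Adm := by
  constructor <;> norm_num [d145θ, Params.pos]

/-- Its corner-cap A leading coefficient is non-zero. [folklore] -/
theorem d145θ_a0 : d145θ.a0 ≠ 0 := by norm_num [d145θ]

end Summit.NavierStokesRegularity.NavierStokesRegularity.Theorems.VirtualFloor.GapFamily

end
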